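import Literature.Analysis.FluidPDE.LogLipschitzKernelBounds
import Literature.Analysis.FluidPDE.RegularizedNewtonKernel
import Mathlib.Analysis.Calculus.Rademacher
import HarnessLib

/-!
# The Biot–Savart identity for Lipschitz compactly supported fields and the log-Lipschitz bound

Analysis/FluidPDE support file (theorems only, no definitions, no named facts) on the discharge
path of the named fact
`Literature.Analysis.FluidPDE.ShirotaYanagisawa1993_periodicCylinderLogDivCurlEstimate`
(`Ferrari1993LogEstimateReduction.lean`; Shirota–Yanagisawa 1993, (15) p. 80; Ferrari 1993,
Cor. 1 (31) p. 286). Third file of the plan described in `LogLipschitzKernelBounds.lean`: the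
velocity, reflected across the wall and cut off, is a **Lipschitz** compactly supported field
`w : ℝ³ → ℝ³` (not `C¹`: its derivative jumps across the wall), and this file proves for such
fields, with `∂ⱼwᵢ(y) = lineDeriv ℝ (w · i) y eⱼ` the a.e. partial derivatives (Rademacher),
`Ωⱼᵢ = ∂ⱼwᵢ − ∂ᵢwⱼ` the vorticity two-form and `D = Σⱼ ∂ⱼwⱼ` the divergence:

* `integral_fderiv_regNewtonGrad_mul_eq` — **integration by parts against the regularised
  kernel** (Mathlib's `LipschitzWith.integral_lineDeriv_mul_eq`):
  `∫ ∂_b(K_a)(x − y) w_c(y) dy = ∫ K_a(x − y) ∂_b w_c(y) dy`, `K_a = regNewtonGrad ε a`, `ε ≠ 0`;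
* `integral_regDelta_mul_eq_sum` — **the Biot–Savart identity at level `ε`**:
  `∫ regDelta ε (x − y) wᵢ(y) dy = Σⱼ ∫ Kⱼ(x − y) Ωⱼᵢ(y) dy + ∫ Kᵢ(x − y) D(y) dy`
  (from `Σⱼ ∂ⱼKⱼ = regDelta ε`, `sum_fderiv_regNewtonGrad`, and `∂ᵢKⱼ = ∂ⱼKᵢ`,
  `fderiv_regNewtonGrad_symm`; this is `w = Σⱼ ∂ⱼΓ ⋆ ∂ⱼw = ∂ⱼΓ ⋆ Ωⱼ. + ∂ᵢΓ ⋆ D` mollified —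
  Majda–Bertozzi (2.95)/(2.119), Gilbarg–Trudinger (2.17));
* `exists_norm_sub_le_of_lipschitz_decomposition` — **the log-Lipschitz bound**: there is an
  absolute constant `c` such that, whenever on `B(x, R)` the vorticity and divergence of `w`
  decompose a.e. as `Ωⱼᵢ = Bⱼᵢ + Fⱼᵢ`, `D = E + F_D` with `|B| ≤ M`, `|E(y)| ≤ Λ|x − y|`, `F`'s
  vanishing on `B(x, R/2)` with `∫|F| ≤ I`, and `w` vanishes off `B(x, R)`, then for
  `0 < |x − z| ≤ R/4`,
  `‖w(x) − w(z)‖ ≤ c (M|x − z|(1 + log(R/|x − z|)) + Λ|x − z| R + I|x − z| R⁻³)`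
  (the kernel bounds of `LogLipschitzKernelBounds.lean`, uniform in `ε`, and `ε → 0` through the
  approximate identity estimate `abs_integral_regDelta_mul_sub_le`).

In the discharge `B` is the (reflected) vorticity cut off near `x`, `E` the divergence defect of
the reflected field and `F` the cut-off terms; see `LogLipschitzKernelBounds.lean`.

## Mathlib / tree search

Mathlib (used): `LipschitzWith.integral_lineDeriv_mul_eq`, `lineDeriv_neg`,
`norm_lineDeriv_le_of_lipschitz`, `Filter.EventuallyEq.lineDeriv_eq`, `measurable_lineDeriv`,
`HasFDerivAt.hasLineDerivAt`, `Integrable.bdd_mul`, `integral_finsetSum`; tree: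
`LogLipschitzKernelBounds`, `RegularizedNewtonKernel` (all used). No Biot–Savart identity for
non-smooth fields in the tree (`lean search 'lineDeriv.*newton|Lipschitz.*BiotSavart'`: nothing;
`LocalBiotSavart.lean` needs `ContDiff ℝ ∞` on all of `ℝ³`).

## References

* A. J. Majda, A. L. Bertozzi, *Vorticity and Incompressible Flow*, CUP 2002, §2.4
  ((2.95), (2.119): `v = K ⋆ ω`) and Lemma 8.1. [MajdaBertozziCUP2002]
* D. Gilbarg, N. S. Trudinger, *Elliptic Partial Differential Equations of Second Order* (2001),
  §2.4 (2.17) (the representation by the Newtonian kernel). [GilbargTrudinger2001]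
-/

noncomputable section

open MeasureTheory Set Function Filter Metric Real
open _root_.Topology
open scoped NNReal ENNReal RealInnerProductSpace

namespace Literature.Analysis.FluidPDE

namespace NewtonPotentialHolder

variable {ε : ℝ} {C : ℝ≥0} {w : EuclideanSpace ℝ (Fin 3) → EuclideanSpace ℝ (Fin 3)}

/-! ### Preliminaries on Lipschitz compactly supported fields -/

/-- `y ↦ x − y` is `1`-Lipschitz. [folklore] -/
theorem lipschitzWith_const_sub (x : EuclideanSpace ℝ (Fin 3)) :
    LipschitzWith 1 fun y : EuclideanSpace ℝ (Fin 3) => x - y :=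
  LipschitzWith.of_dist_le_mul fun a b => by
    rw [dist_eq_norm, dist_eq_norm, sub_sub_sub_cancel_left, norm_sub_rev, NNReal.coe_one, one_mul]

/-- The components of a compactly supported field are compactly supported. [folklore] -/
theorem hasCompactSupport_apply (hwc : HasCompactSupport w) (i : Fin 3) :
    HasCompactSupport fun y => w y i :=
  hwc.comp_left (g := fun v : EuclideanSpace ℝ (Fin 3) => v i) rfl

/-- The support of a component lies in the support of the field. [folklore] -/
theorem tsupport_apply_subset (w : EuclideanSpace ℝ (Fin 3) → EuclideanSpace ℝ (Fin 3)) (i : Fin 3) :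
    tsupport (fun y => w y i) ⊆ tsupport w := by
  refine closure_mono fun y hy => ?_
  rw [mem_support] at hy ⊢
  intro h
  exact hy (by rw [h]; rfl)

/-- **The a.e. partial derivatives of a Lipschitz function are bounded**:
`|lineDeriv ℝ g y eⱼ| ≤ C` for a `C`-Lipschitz `g`. [folklore] -/
theorem abs_lineDeriv_single_le {g : EuclideanSpace ℝ (Fin 3) → ℝ} (hg : LipschitzWith C g)
    (y : EuclideanSpace ℝ (Fin 3)) (j : Fin 3) :
    |lineDeriv ℝ g y (EuclideanSpace.single j (1 : ℝ))| ≤ C := by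
  have h := norm_lineDeriv_le_of_lipschitz ℝ (v := EuclideanSpace.single j (1 : ℝ)) (x₀ := y) hg
  rw [Real.norm_eq_abs] at h
  simpa using h

/-- The line derivative vanishes off the topological support. [folklore] -/
theorem lineDeriv_eq_zero_of_notMem_tsupport {g : EuclideanSpace ℝ (Fin 3) → ℝ}
    {y : EuclideanSpace ℝ (Fin 3)} (hy : y ∉ tsupport g) (v : EuclideanSpace ℝ (Fin 3)) :
    lineDeriv ℝ g y v = 0 := by
  rw [(notMem_tsupport_iff_eventuallyEq.1 hy).lineDeriv_eq]
  simp [lineDeriv]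

/-- A bounded a.e.-strongly measurable function vanishing off a compact set is integrable.
[folklore] -/
theorem integrable_of_bounded_of_eq_zero {f : EuclideanSpace ℝ (Fin 3) → ℝ}
    (hf : AEStronglyMeasurable f volume) {M : ℝ} (hfM : ∀ y, |f y| ≤ M)
    {K : Set (EuclideanSpace ℝ (Fin 3))} (hK : IsCompact K) (hfK : ∀ y ∉ K, f y = 0) :
    Integrable f volume := by
  have hon : IntegrableOn f K volume := by
    refine Measure.integrableOn_of_bounded (M := M) hK.measure_lt_top.ne hf ?_
    exact Eventually.of_forall fun y => by rw [Real.norm_eq_abs]; exact hfM y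
  refine (integrableOn_iff_integrable_of_support_subset fun y hy => ?_).1 hon
  by_contra h
  exact hy (hfK y h)

/-- **A bounded density vanishing off a compact set, times a continuous kernel, is integrable.**
[folklore] -/
theorem integrable_mul_of_bounded_of_tsupport {k f : EuclideanSpace ℝ (Fin 3) → ℝ}
    (hk : Continuous k) (hf : AEStronglyMeasurable f volume) {M : ℝ} (hfM : ∀ y, |f y| ≤ M)
    {K : Set (EuclideanSpace ℝ (Fin 3))} (hK : IsCompact K) (hfK : ∀ y ∉ K, f y = 0) :
    Integrable (fun y => k y * f y) volume := by
  -- `f` is integrable: bounded on the compact `K`, zero outside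
  have hfi : Integrable f volume := integrable_of_bounded_of_eq_zero hf hfM hK hfK
  -- `k` is bounded on `K`; modify `k` off `K` (where `f = 0`)
  obtain ⟨B, hB⟩ := hK.exists_bound_of_continuousOn hk.continuousOn
  have heq : (fun y => k y * f y) = fun y => K.indicator k y * f y := by
    funext y
    by_cases hy : y ∈ K
    · rw [indicator_of_mem hy]
    · rw [indicator_of_notMem hy, hfK y hy, mul_zero, mul_zero]
  rw [heq]
  refine hfi.bdd_mul (c := max B 0) ((hk.measurable.indicator hK.measurableSet).aestronglyMeasurable)
    (Eventually.of_forall fun y => ?_)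
  by_cases hy : y ∈ K
  · rw [indicator_of_mem hy]
    exact (hB y hy).trans (le_max_left _ _)
  · rw [indicator_of_notMem hy, norm_zero]
    exact le_max_right _ _

/-! ### Integration by parts against the regularised kernel -/

/-- The translated kernel `y ↦ K_a(x − y)` is Lipschitz (for `ε ≠ 0`). [folklore] -/
theorem lipschitzWith_regNewtonGrad_comp_sub (hε : ε ≠ 0) (a : Fin 3) (x : EuclideanSpace ℝ (Fin 3)) :
    LipschitzWith (Real.toNNReal (π⁻¹ * (ε ^ 2) ^ (-(3 / 2 : ℝ))) * 1)
      fun y => regNewtonGrad ε a (x - y) :=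
  (lipschitzWith_regNewtonGrad hε a).comp (lipschitzWith_const_sub x)

/-- The line derivative of the translated kernel:
`lineDeriv (y ↦ K_a(x − y)) y v = −DK_a(x − y) v`. [folklore] -/
theorem lineDeriv_regNewtonGrad_comp_sub (hε : ε ≠ 0) (a : Fin 3) (x y v : EuclideanSpace ℝ (Fin 3)) :
    lineDeriv ℝ (fun y => regNewtonGrad ε a (x - y)) y v =
      -(fderiv ℝ (regNewtonGrad ε a) (x - y) v) := by
  have h1 : HasFDerivAt (fun y : EuclideanSpace ℝ (Fin 3) => x - y)
      (-(ContinuousLinearMap.id ℝ (EuclideanSpace ℝ (Fin 3)))) y :=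
    (hasFDerivAt_id y).const_sub x
  have h2 : HasFDerivAt (fun y : EuclideanSpace ℝ (Fin 3) => regNewtonGrad ε a (x - y))
      ((fderiv ℝ (regNewtonGrad ε a) (x - y)).comp
        (-(ContinuousLinearMap.id ℝ (EuclideanSpace ℝ (Fin 3))))) y := by
    have h := (hasFDerivAt_regNewtonGrad hε a (x - y)).comp y h1
    rwa [(hasFDerivAt_regNewtonGrad hε a (x - y)).fderiv]
  rw [(h2.hasLineDerivAt v).lineDeriv]
  simp

/-- **Integration by parts against the regularised kernel**: for a field with `C`-Lipschitz,
compactly supported components, `ε ≠ 0`, and indices `a, b, c`,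
`∫ ∂_b(K_a)(x − y) w_c(y) dy = ∫ K_a(x − y) ∂_b w_c(y) dy` with `K_a = regNewtonGrad ε a` and
`∂_b w_c = lineDeriv ℝ (w · c) · e_b` (Mathlib's `LipschitzWith.integral_lineDeriv_mul_eq` with
`lineDeriv (K_a(x − ·)) = −DK_a(x − ·)` and `lineDeriv g y (−v) = −lineDeriv g y v`). [folklore] -/
theorem integral_fderiv_regNewtonGrad_mul_eq (hε : ε ≠ 0) (hw : ∀ i, LipschitzWith C fun y => w y i)
    (hwc : HasCompactSupport w) (x : EuclideanSpace ℝ (Fin 3)) (a b c : Fin 3) :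
    ∫ y, fderiv ℝ (regNewtonGrad ε a) (x - y) (EuclideanSpace.single b (1 : ℝ)) * w y c =
      ∫ y, regNewtonGrad ε a (x - y) *
        lineDeriv ℝ (fun y => w y c) y (EuclideanSpace.single b (1 : ℝ)) := by
  have hibp := (lipschitzWith_regNewtonGrad_comp_sub hε a x).integral_lineDeriv_mul_eq (hw c)
    (hasCompactSupport_apply hwc c) (EuclideanSpace.single b (1 : ℝ)) (μ := volume)
  simp_rw [lineDeriv_regNewtonGrad_comp_sub hε, lineDeriv_neg, neg_mul, integral_neg, neg_inj] at hibp
  rw [hibp]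
  refine integral_congr_ae (Eventually.of_forall fun y => ?_)
  simp only
  ring

/-- Integrability of `K_a(x − ·)` against an a.e. partial derivative of a Lipschitz compactly
supported field (continuous kernel, bounded density vanishing off the compact support).
[folklore] -/
theorem integrable_regNewtonGrad_mul_lineDeriv (hε : ε ≠ 0) (hw : ∀ i, LipschitzWith C fun y => w y i)
    (hwc : HasCompactSupport w) (x : EuclideanSpace ℝ (Fin 3)) (a b c : Fin 3) :
    Integrable (fun y => regNewtonGrad ε a (x - y) *
      lineDeriv ℝ (fun y => w y c) y (EuclideanSpace.single b (1 : ℝ))) volume := by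
  refine integrable_mul_of_bounded_of_tsupport ((continuous_regNewtonGrad hε a).comp
    (continuous_const.sub continuous_id))
    (measurable_lineDeriv (hw c).continuous).aestronglyMeasurable
    (fun y => abs_lineDeriv_single_le (hw c) y b) hwc (fun y hy => ?_)
  exact lineDeriv_eq_zero_of_notMem_tsupport (fun h => hy (tsupport_apply_subset w c h)) _

/-- Integrability of `K_a(x − ·)` against the vorticity entry `Ω_bc = ∂_b w_c − ∂_c w_b`.
[folklore] -/
theorem integrable_regNewtonGrad_mul_vort (hε : ε ≠ 0) (hw : ∀ i, LipschitzWith C fun y => w y i)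
    (hwc : HasCompactSupport w) (x : EuclideanSpace ℝ (Fin 3)) (a b c : Fin 3) :
    Integrable (fun y => regNewtonGrad ε a (x - y) *
      (lineDeriv ℝ (fun y => w y c) y (EuclideanSpace.single b (1 : ℝ)) -
        lineDeriv ℝ (fun y => w y b) y (EuclideanSpace.single c (1 : ℝ)))) volume := by
  have h := (integrable_regNewtonGrad_mul_lineDeriv hε hw hwc x a b c).sub
    (integrable_regNewtonGrad_mul_lineDeriv hε hw hwc x a c b)
  refine h.congr (Eventually.of_forall fun y => ?_)
  simp only [Pi.sub_apply]
  ring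

/-- Integrability of `K_a(x − ·)` against the divergence `D = Σⱼ ∂ⱼ wⱼ`. [folklore] -/
theorem integrable_regNewtonGrad_mul_div (hε : ε ≠ 0) (hw : ∀ i, LipschitzWith C fun y => w y i)
    (hwc : HasCompactSupport w) (x : EuclideanSpace ℝ (Fin 3)) (a : Fin 3) :
    Integrable (fun y => regNewtonGrad ε a (x - y) *
      ∑ j, lineDeriv ℝ (fun y => w y j) y (EuclideanSpace.single j (1 : ℝ))) volume := by
  have h := integrable_finsetSum Finset.univ
    fun j (_ : j ∈ Finset.univ) => integrable_regNewtonGrad_mul_lineDeriv hε hw hwc x a j j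
  refine h.congr (Eventually.of_forall fun y => ?_)
  simp only [Finset.mul_sum]

/-! ### The Biot–Savart identity at level `ε` -/

/-- **First form of the identity**: `∫ regDelta ε (x − y) wᵢ(y) dy = Σⱼ ∫ Kⱼ(x − y) ∂ⱼwᵢ(y) dy`
(`Σⱼ ∂ⱼKⱼ = regDelta ε` and integration by parts). [cite: GilbargTrudinger2001, (2.17)] -/
theorem integral_regDelta_mul_eq_sum_grad (hε : ε ≠ 0) (hw : ∀ i, LipschitzWith C fun y => w y i)
    (hwc : HasCompactSupport w) (x : EuclideanSpace ℝ (Fin 3)) (i : Fin 3) :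
    ∫ y, regDelta ε (x - y) * w y i =
      ∑ j, ∫ y, regNewtonGrad ε j (x - y) *
        lineDeriv ℝ (fun y => w y i) y (EuclideanSpace.single j (1 : ℝ)) := by
  have hterm : ∀ j : Fin 3, Integrable (fun y => fderiv ℝ (regNewtonGrad ε j) (x - y)
      (EuclideanSpace.single j (1 : ℝ)) * w y i) volume := by
    intro j
    have hk : Continuous fun y => fderiv ℝ (regNewtonGrad ε j) (x - y)
        (EuclideanSpace.single j (1 : ℝ)) :=
      (((contDiff_regNewtonGrad hε j (n := 1)).continuous_fderiv one_ne_zero).comp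
        (continuous_const.sub continuous_id)).clm_apply continuous_const
    exact (hk.mul (hw i).continuous).integrable_of_hasCompactSupport
      ((hasCompactSupport_apply hwc i).mul_left)
  calc ∫ y, regDelta ε (x - y) * w y i
      = ∫ y, ∑ j, fderiv ℝ (regNewtonGrad ε j) (x - y) (EuclideanSpace.single j (1 : ℝ)) * w y i := by
        refine integral_congr_ae (Eventually.of_forall fun y => ?_)
        simp only
        rw [← Finset.sum_mul, sum_fderiv_regNewtonGrad hε]
    _ = ∑ j, ∫ y, fderiv ℝ (regNewtonGrad ε j) (x - y) (EuclideanSpace.single j (1 : ℝ)) * w y i :=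
        integral_finsetSum Finset.univ fun j _ => hterm j
    _ = ∑ j, ∫ y, regNewtonGrad ε j (x - y) *
          lineDeriv ℝ (fun y => w y i) y (EuclideanSpace.single j (1 : ℝ)) := by
        refine Finset.sum_congr rfl fun j _ => ?_
        exact integral_fderiv_regNewtonGrad_mul_eq hε hw hwc x j j i

/-- **The divergence swap**: `∫ Kⱼ(x − y) ∂ᵢwⱼ(y) dy = ∫ Kᵢ(x − y) ∂ⱼwⱼ(y) dy` (both equal
`∫ ∂ᵢKⱼ(x − y) wⱼ(y) dy = ∫ ∂ⱼKᵢ(x − y) wⱼ(y) dy` by `∂ᵢKⱼ = ∂ⱼKᵢ`). [folklore] -/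
theorem integral_regNewtonGrad_mul_lineDeriv_swap (hε : ε ≠ 0)
    (hw : ∀ i, LipschitzWith C fun y => w y i) (hwc : HasCompactSupport w)
    (x : EuclideanSpace ℝ (Fin 3)) (i j : Fin 3) :
    ∫ y, regNewtonGrad ε j (x - y) * lineDeriv ℝ (fun y => w y j) y (EuclideanSpace.single i (1 : ℝ)) =
      ∫ y, regNewtonGrad ε i (x - y) *
        lineDeriv ℝ (fun y => w y j) y (EuclideanSpace.single j (1 : ℝ)) := by
  rw [← integral_fderiv_regNewtonGrad_mul_eq hε hw hwc x j i j,
    ← integral_fderiv_regNewtonGrad_mul_eq hε hw hwc x i j j]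
  refine integral_congr_ae (Eventually.of_forall fun y => ?_)
  simp only
  rw [fderiv_regNewtonGrad_symm hε]

/-- **The Biot–Savart identity for a Lipschitz compactly supported field, at level `ε ≠ 0`**:
`∫ regDelta ε (x − y) wᵢ(y) dy = Σⱼ ∫ Kⱼ(x − y) (∂ⱼwᵢ − ∂ᵢwⱼ)(y) dy + ∫ Kᵢ(x − y) (Σⱼ ∂ⱼwⱼ)(y) dy`,
`Kⱼ = regNewtonGrad ε j`, the a.e. partial derivatives being line derivatives (Rademacher). For
smooth `w` and `ε → 0` this is `w = ∇Γ ⋆∧ curl w + ∇Γ ⋆ div w` (Majda–Bertozzi (2.119),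
Gilbarg–Trudinger (2.17)). [cite: MajdaBertozziCUP2002, §2.4 (2.119)] -/
theorem integral_regDelta_mul_eq_sum (hε : ε ≠ 0) (hw : ∀ i, LipschitzWith C fun y => w y i)
    (hwc : HasCompactSupport w) (x : EuclideanSpace ℝ (Fin 3)) (i : Fin 3) :
    ∫ y, regDelta ε (x - y) * w y i =
      (∑ j, ∫ y, regNewtonGrad ε j (x - y) *
        (lineDeriv ℝ (fun y => w y i) y (EuclideanSpace.single j (1 : ℝ)) -
          lineDeriv ℝ (fun y => w y j) y (EuclideanSpace.single i (1 : ℝ)))) +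
      ∫ y, regNewtonGrad ε i (x - y) *
        ∑ j, lineDeriv ℝ (fun y => w y j) y (EuclideanSpace.single j (1 : ℝ)) := by
  rw [integral_regDelta_mul_eq_sum_grad hε hw hwc x i]
  -- split `∂ⱼwᵢ = (∂ⱼwᵢ - ∂ᵢwⱼ) + ∂ᵢwⱼ` under each integral
  have hsplit : ∀ j : Fin 3, ∫ y, regNewtonGrad ε j (x - y) *
      lineDeriv ℝ (fun y => w y i) y (EuclideanSpace.single j (1 : ℝ)) =
      (∫ y, regNewtonGrad ε j (x - y) *
        (lineDeriv ℝ (fun y => w y i) y (EuclideanSpace.single j (1 : ℝ)) -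
          lineDeriv ℝ (fun y => w y j) y (EuclideanSpace.single i (1 : ℝ)))) +
      ∫ y, regNewtonGrad ε j (x - y) *
        lineDeriv ℝ (fun y => w y j) y (EuclideanSpace.single i (1 : ℝ)) := by
    intro j
    rw [← integral_add (integrable_regNewtonGrad_mul_vort hε hw hwc x j j i)
      (integrable_regNewtonGrad_mul_lineDeriv hε hw hwc x j i j)]
    refine integral_congr_ae (Eventually.of_forall fun y => ?_)
    simp only
    ring
  simp_rw [hsplit]
  rw [Finset.sum_add_distrib]
  congr 1
  -- the divergence swap and `∫ Kᵢ Σⱼ ∂ⱼwⱼ = Σⱼ ∫ Kᵢ ∂ⱼwⱼ`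
  simp_rw [integral_regNewtonGrad_mul_lineDeriv_swap hε hw hwc x i]
  rw [← integral_finsetSum Finset.univ
    fun j (_ : j ∈ Finset.univ) => integrable_regNewtonGrad_mul_lineDeriv hε hw hwc x i j j]
  refine integral_congr_ae (Eventually.of_forall fun y => ?_)
  simp only [Finset.mul_sum]

/-! ### The log-Lipschitz bound -/

/-- The regularised kernel is bounded for `ε ≠ 0`: `|regNewtonGrad ε j z| ≤ (4π)⁻¹ (ε²)⁻¹`
(`|zⱼ| ≤ |z| ≤ s^{1/2}`, `s^{1/2} s^{-3/2} = s⁻¹ ≤ ε⁻²`). [folklore] -/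
theorem abs_regNewtonGrad_le_eps (hε : ε ≠ 0) (j : Fin 3) (z : EuclideanSpace ℝ (Fin 3)) :
    |regNewtonGrad ε j z| ≤ (4 * π)⁻¹ * (ε ^ 2)⁻¹ := by
  have hs : 0 < ‖z‖ ^ 2 + ε ^ 2 := normSq_add_sq_pos hε z
  have hε2 : 0 < ε ^ 2 := by positivity
  set s : ℝ := ‖z‖ ^ 2 + ε ^ 2 with hs_def
  have h2 : |z j| ≤ ‖z‖ := by
    have := PiLp.norm_apply_le (p := 2) z j
    rwa [Real.norm_eq_abs] at this
  have hzs : ‖z‖ ≤ s ^ ((1 : ℝ) / 2) := by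
    rw [← Real.sqrt_eq_rpow]
    exact Real.le_sqrt_of_sq_le (by rw [hs_def]; nlinarith)
  rw [regNewtonGrad_apply, abs_mul, abs_mul, abs_of_pos (by positivity : (0 : ℝ) < (4 * π)⁻¹),
    abs_of_pos (Real.rpow_pos_of_pos hs _), mul_assoc]
  refine mul_le_mul_of_nonneg_left ?_ (by positivity)
  calc |z j| * s ^ (-(3 / 2 : ℝ)) ≤ s ^ ((1 : ℝ) / 2) * s ^ (-(3 / 2 : ℝ)) :=
        mul_le_mul_of_nonneg_right (h2.trans hzs) (Real.rpow_nonneg hs.le _)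
    _ = s⁻¹ := by
        rw [← Real.rpow_add hs, show ((1 : ℝ) / 2 + -(3 / 2 : ℝ)) = -1 by norm_num,
          Real.rpow_neg_one]
    _ ≤ (ε ^ 2)⁻¹ := by
        rw [inv_le_inv₀ hs hε2, hs_def]
        nlinarith [norm_nonneg z]

/-- Difference of two kernel integrals of an integrable density against a bounded continuous
kernel: `∫ k(x − y) F(y) dy − ∫ k(z − y) F(y) dy = ∫ (k(x − y) − k(z − y)) F(y) dy`. [folklore] -/
theorem integral_mul_sub_integral_mul {k F : EuclideanSpace ℝ (Fin 3) → ℝ} (hk : Continuous k)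
    {Kb : ℝ} (hkb : ∀ y, |k y| ≤ Kb) (hF : Integrable F volume) (x z : EuclideanSpace ℝ (Fin 3)) :
    (∫ y, k (x - y) * F y) - ∫ y, k (z - y) * F y = ∫ y, (k (x - y) - k (z - y)) * F y := by
  have hint : ∀ p : EuclideanSpace ℝ (Fin 3), Integrable (fun y => k (p - y) * F y) volume := by
    intro p
    refine hF.bdd_mul (c := Kb) ((hk.comp (continuous_const.sub continuous_id)).aestronglyMeasurable)
      (Eventually.of_forall fun y => ?_)
    rw [Real.norm_eq_abs]
    exact hkb _
  rw [← integral_sub (hint x) (hint z)]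
  refine integral_congr_ae (Eventually.of_forall fun y => ?_)
  ring

/-- `ℓ²`-norm by `ℓ¹`-norm on `ℝ³`: `‖v‖ ≤ Σᵢ |vᵢ|`. [folklore] -/
theorem norm_le_sum_abs (v : EuclideanSpace ℝ (Fin 3)) : ‖v‖ ≤ ∑ i, |v i| := by
  have h1 : ‖v‖ ^ 2 = ∑ i, |v i| ^ 2 := by
    rw [EuclideanSpace.real_norm_sq_eq]
    exact Finset.sum_congr rfl fun i _ => (sq_abs _).symm
  have h2 : ∑ i, |v i| ^ 2 ≤ (∑ i, |v i|) ^ 2 :=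
    Finset.sum_sq_le_sq_sum_of_nonneg fun i _ => abs_nonneg _
  have h3 : 0 ≤ ∑ i, |v i| := Finset.sum_nonneg fun i _ => abs_nonneg _
  nlinarith [norm_nonneg v]

section LogLipschitz

variable (hw : ∀ i, LipschitzWith C fun y => w y i) (hwc : HasCompactSupport w)
  {x z : EuclideanSpace ℝ (Fin 3)} (hxz : x ≠ z) {R : ℝ} (hR : 4 * ‖x - z‖ ≤ R)
  {B Fv : Fin 3 → Fin 3 → EuclideanSpace ℝ (Fin 3) → ℝ} {E Fd : EuclideanSpace ℝ (Fin 3) → ℝ}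
  (hBm : ∀ j i, AEStronglyMeasurable (B j i) volume) (hEm : AEStronglyMeasurable E volume)
  (hFvi : ∀ j i, Integrable (Fv j i) volume) (hFdi : Integrable Fd volume)
  (hΩ : ∀ j i, (fun y => lineDeriv ℝ (fun y => w y i) y (EuclideanSpace.single j (1 : ℝ)) -
      lineDeriv ℝ (fun y => w y j) y (EuclideanSpace.single i (1 : ℝ))) =ᵐ[volume]
      fun y => B j i y + Fv j i y)
  (hD : (fun y => ∑ j, lineDeriv ℝ (fun y => w y j) y (EuclideanSpace.single j (1 : ℝ))) =ᵐ[volume]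
      fun y => E y + Fd y)
  {M Λ I : ℝ} (hM : 0 ≤ M) (hΛ : 0 ≤ Λ) (hI : 0 ≤ I)
  (hB : ∀ j i y, |B j i y| ≤ M) (hBR : ∀ j i y, R ≤ ‖x - y‖ → B j i y = 0)
  (hE : ∀ y, |E y| ≤ Λ * ‖x - y‖) (hER : ∀ y, R ≤ ‖x - y‖ → E y = 0)
  (hFvn : ∀ j i y, ‖x - y‖ < R / 2 → Fv j i y = 0) (hFvR : ∀ j i y, R ≤ ‖x - y‖ → Fv j i y = 0)
  (hFvI : ∀ j i, ∫ y, |Fv j i y| ≤ I)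
  (hFdn : ∀ y, ‖x - y‖ < R / 2 → Fd y = 0) (hFdR : ∀ y, R ≤ ‖x - y‖ → Fd y = 0)
  (hFdI : ∫ y, |Fd y| ≤ I)
set_option maxHeartbeats 400000 in -- buildfix (bf3-g27): 160k/180k FAIL, 200k PASS at accept time; line-neutral budget line
include hw hwc hxz hR hBm hEm hFvi hFdi hΩ hD hM hΛ hI hB hBR hE hER hFvn hFvR hFvI hFdn hFdR hFdI in
/-- **The log-Lipschitz bound at level `ε`** (the heart of Yudovich's estimate): with the
vorticity and divergence of the Lipschitz field `w` decomposed a.e. as `Ω = B + F`, `D = E + F_D`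
(`|B| ≤ M` vanishing off `B(x, R)`; `|E(y)| ≤ Λ|x − y|` vanishing off `B(x, R)`; `F`'s vanishing on
`B(x, R/2)` and off `B(x, R)` with `∫|F| ≤ I`), for every `ε ≠ 0`, component `i` and
`0 < 4|x − z| ≤ R`,
`|∫ regDelta ε (x − y) wᵢ − ∫ regDelta ε (z − y) wᵢ| ≤ K₀ (M d (1 + log(R/d)) + Λ d R + I d R⁻³)`,
`d = |x − z|`, `K₀ = 3(5A + B)c₃ + (2A + B)c₃ + 32B` with `A = (4π)⁻¹`, `B = 8/π`, `c₃ = 3|B₁|`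
(the Biot–Savart identity at level `ε` and the three kernel bounds, uniform in `ε`).
[cite: MajdaBertozziCUP2002, Lemma 8.1 (proof)] -/
theorem abs_integral_regDelta_sub_le (hε : ε ≠ 0) (i : Fin 3) :
    |(∫ y, regDelta ε (x - y) * w y i) - ∫ y, regDelta ε (z - y) * w y i| ≤
      (3 * (5 * (4 * π)⁻¹ + 8 / π) * (3 * (volume : Measure (EuclideanSpace ℝ (Fin 3))).real (ball 0 1)) +
        (2 * (4 * π)⁻¹ + 8 / π) * (3 * (volume : Measure (EuclideanSpace ℝ (Fin 3))).real (ball 0 1)) +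
        32 * (8 / π)) *
      (M * ‖x - z‖ * (1 + Real.log (R / ‖x - z‖)) + Λ * ‖x - z‖ * R + I * ‖x - z‖ / R ^ 3) := by
  -- basic facts
  have hA0 : 0 ≤ (4 * π)⁻¹ := by positivity
  have hB0 : (0 : ℝ) ≤ 8 / π := by positivity
  have hc₃0 : 0 ≤ 3 * (volume : Measure (EuclideanSpace ℝ (Fin 3))).real (ball 0 1) :=
    three_mul_volume_real_ball_nonneg
  have hd : 0 < ‖x - z‖ := norm_pos_iff.2 (sub_ne_zero.2 hxz)
  have hR2 : 2 * ‖x - z‖ ≤ R := by linarith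
  have hR0 : 0 < R := by linarith
  have hk : ∀ j, IsSingularKernel (regNewtonGrad ε j) 2 (4 * π)⁻¹ (8 / π) := fun j =>
    isSingularKernel_regNewtonGrad hε j
  have hkc : ∀ j, Continuous (regNewtonGrad ε j) := fun j => continuous_regNewtonGrad hε j
  have hkb : ∀ j y, |regNewtonGrad ε j y| ≤ (4 * π)⁻¹ * (ε ^ 2)⁻¹ := fun j y =>
    abs_regNewtonGrad_le_eps hε j y
  -- compact set carrying `B`, `E`; integrability of the densities
  have hK : IsCompact (closedBall x R) := isCompact_closedBall x R
  have hoff : ∀ y ∉ closedBall x R, R ≤ ‖x - y‖ := fun y hy => by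
    rw [mem_closedBall, not_le, dist_eq_norm, norm_sub_rev] at hy
    exact hy.le
  have hBi : ∀ j, Integrable (B j i) volume := fun j =>
    integrable_of_bounded_of_eq_zero (hBm j i) (hB j i) hK fun y hy => hBR j i y (hoff y hy)
  have hE' : ∀ y, |E y| ≤ Λ * R := by
    intro y
    by_cases hy : R ≤ ‖x - y‖
    · rw [hER y hy, abs_zero]; positivity
    · exact (hE y).trans (mul_le_mul_of_nonneg_left (not_le.1 hy).le hΛ)
  have hEi : Integrable E volume :=
    integrable_of_bounded_of_eq_zero hEm hE' hK fun y hy => hER y (hoff y hy)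
  have hkFi : ∀ (j : Fin 3) (G : EuclideanSpace ℝ (Fin 3) → ℝ), Integrable G volume →
      ∀ p : EuclideanSpace ℝ (Fin 3), Integrable (fun y => regNewtonGrad ε j (p - y) * G y) volume :=
    fun j G hG p => hG.bdd_mul (c := (4 * π)⁻¹ * (ε ^ 2)⁻¹)
      (((hkc j).comp (continuous_const.sub continuous_id)).aestronglyMeasurable)
      (Eventually.of_forall fun y => by rw [Real.norm_eq_abs]; exact hkb j _)
  -- the identity at a point `p`, with the decompositions inserted
  have hrep : ∀ p : EuclideanSpace ℝ (Fin 3), ∫ y, regDelta ε (p - y) * w y i =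
      ∑ j, ((∫ y, regNewtonGrad ε j (p - y) * B j i y) + ∫ y, regNewtonGrad ε j (p - y) * Fv j i y) +
        ((∫ y, regNewtonGrad ε i (p - y) * E y) + ∫ y, regNewtonGrad ε i (p - y) * Fd y) := by
    intro p
    rw [integral_regDelta_mul_eq_sum hε hw hwc p i]
    congr 1
    · refine Finset.sum_congr rfl fun j _ => ?_
      have hae : (fun y => regNewtonGrad ε j (p - y) *
          (lineDeriv ℝ (fun y => w y i) y (EuclideanSpace.single j (1 : ℝ)) -
            lineDeriv ℝ (fun y => w y j) y (EuclideanSpace.single i (1 : ℝ)))) =ᵐ[volume]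
          fun y => regNewtonGrad ε j (p - y) * B j i y + regNewtonGrad ε j (p - y) * Fv j i y := by
        filter_upwards [hΩ j i] with y hy
        rw [hy, mul_add]
      rw [integral_congr_ae hae, integral_add (hkFi j _ (hBi j) p) (hkFi j _ (hFvi j i) p)]
    · have hae : (fun y => regNewtonGrad ε i (p - y) *
          ∑ j, lineDeriv ℝ (fun y => w y j) y (EuclideanSpace.single j (1 : ℝ))) =ᵐ[volume]
          fun y => regNewtonGrad ε i (p - y) * E y + regNewtonGrad ε i (p - y) * Fd y := by
        filter_upwards [hD] with y hy
        rw [hy, mul_add]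
      rw [integral_congr_ae hae, integral_add (hkFi i _ hEi p) (hkFi i _ hFdi p)]
  -- the four kinds of differences and their bounds
  have bB : ∀ j, |(∫ y, regNewtonGrad ε j (x - y) * B j i y) - ∫ y, regNewtonGrad ε j (z - y) * B j i y| ≤
      M * (3 * (volume : Measure (EuclideanSpace ℝ (Fin 3))).real (ball 0 1)) * ‖x - z‖ *
        (5 * (4 * π)⁻¹ + 8 / π * Real.log (R / (2 * ‖x - z‖))) := by
    intro j
    rw [integral_mul_sub_integral_mul (hkc j) (hkb j) (hBi j) x z]
    exact (abs_integral_kernel_sub_mul_le_log (hk j) hA0 hB0 (hBm j i) hM (hB j i) hxz hR2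
      (hBR j i)).2
  have bF : ∀ j, |(∫ y, regNewtonGrad ε j (x - y) * Fv j i y) - ∫ y, regNewtonGrad ε j (z - y) * Fv j i y| ≤
      8 * (8 / π) * ‖x - z‖ / R ^ 3 * I := by
    intro j
    rw [integral_mul_sub_integral_mul (hkc j) (hkb j) (hFvi j i) x z]
    refine (abs_integral_kernel_sub_mul_le_far (hk j) hB0 (hFvi j i) hxz hR (hFvn j i)
      (hFvR j i)).2.trans ?_
    exact mul_le_mul_of_nonneg_left (hFvI j i) (by positivity)
  have bE : |(∫ y, regNewtonGrad ε i (x - y) * E y) - ∫ y, regNewtonGrad ε i (z - y) * E y| ≤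
      Λ * (3 * (volume : Measure (EuclideanSpace ℝ (Fin 3))).real (ball 0 1)) * ‖x - z‖ *
        (8 * (4 * π)⁻¹ * ‖x - z‖ + 8 / π * R) := by
    rw [integral_mul_sub_integral_mul (hkc i) (hkb i) hEi x z]
    exact (abs_integral_kernel_sub_mul_le_of_le_mul_norm (hk i) hA0 hB0 hEm hΛ hE hxz hR2 hER).2
  have bD : |(∫ y, regNewtonGrad ε i (x - y) * Fd y) - ∫ y, regNewtonGrad ε i (z - y) * Fd y| ≤
      8 * (8 / π) * ‖x - z‖ / R ^ 3 * I := by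
    rw [integral_mul_sub_integral_mul (hkc i) (hkb i) hFdi x z]
    refine (abs_integral_kernel_sub_mul_le_far (hk i) hB0 hFdi hxz hR hFdn hFdR).2.trans ?_
    exact mul_le_mul_of_nonneg_left hFdI (by positivity)
  -- assemble
  rw [hrep x, hrep z]
  have hsplit :
      (∑ j, ((∫ y, regNewtonGrad ε j (x - y) * B j i y) + ∫ y, regNewtonGrad ε j (x - y) * Fv j i y) +
        ((∫ y, regNewtonGrad ε i (x - y) * E y) + ∫ y, regNewtonGrad ε i (x - y) * Fd y)) -
      (∑ j, ((∫ y, regNewtonGrad ε j (z - y) * B j i y) + ∫ y, regNewtonGrad ε j (z - y) * Fv j i y) +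
        ((∫ y, regNewtonGrad ε i (z - y) * E y) + ∫ y, regNewtonGrad ε i (z - y) * Fd y)) =
      ∑ j, (((∫ y, regNewtonGrad ε j (x - y) * B j i y) - ∫ y, regNewtonGrad ε j (z - y) * B j i y) +
        ((∫ y, regNewtonGrad ε j (x - y) * Fv j i y) - ∫ y, regNewtonGrad ε j (z - y) * Fv j i y)) +
      (((∫ y, regNewtonGrad ε i (x - y) * E y) - ∫ y, regNewtonGrad ε i (z - y) * E y) +
        ((∫ y, regNewtonGrad ε i (x - y) * Fd y) - ∫ y, regNewtonGrad ε i (z - y) * Fd y)) := by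
    simp only [Finset.sum_add_distrib, Finset.sum_sub_distrib]
    ring
  rw [hsplit]
  have hsum : |∑ j, (((∫ y, regNewtonGrad ε j (x - y) * B j i y) - ∫ y, regNewtonGrad ε j (z - y) * B j i y) +
        ((∫ y, regNewtonGrad ε j (x - y) * Fv j i y) - ∫ y, regNewtonGrad ε j (z - y) * Fv j i y))| ≤
      ∑ _j : Fin 3, (M * (3 * (volume : Measure (EuclideanSpace ℝ (Fin 3))).real (ball 0 1)) * ‖x - z‖ *
        (5 * (4 * π)⁻¹ + 8 / π * Real.log (R / (2 * ‖x - z‖))) + 8 * (8 / π) * ‖x - z‖ / R ^ 3 * I) := by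
    refine (Finset.abs_sum_le_sum_abs _ _).trans (Finset.sum_le_sum fun j _ => ?_)
    exact (abs_add_le _ _).trans (add_le_add (bB j) (bF j))
  rw [Finset.sum_const, Finset.card_univ, Fintype.card_fin, nsmul_eq_mul, Nat.cast_ofNat] at hsum
  refine ((abs_add_le _ _).trans (add_le_add hsum ((abs_add_le _ _).trans (add_le_add bE bD)))).trans ?_
  -- arithmetic: compare with `K₀ (M d (1 + L) + Λ d R + I d / R³)`, `L = log(R/d)`, `d = |x - z|`
  have hlog2 : Real.log (R / (2 * ‖x - z‖)) ≤ Real.log (R / ‖x - z‖) :=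
    Real.log_le_log (by positivity) (by
      rw [div_le_div_iff₀ (by positivity) hd]
      nlinarith)
  have hlog0 : 0 ≤ Real.log (R / ‖x - z‖) := Real.log_nonneg ((one_le_div hd).2 (by linarith))
  have hlog2' : 0 ≤ Real.log (R / (2 * ‖x - z‖)) :=
    Real.log_nonneg ((one_le_div (by positivity)).2 hR2)
  have T1 : 3 * (M * (3 * (volume : Measure (EuclideanSpace ℝ (Fin 3))).real (ball 0 1)) * ‖x - z‖ *
        (5 * (4 * π)⁻¹ + 8 / π * Real.log (R / (2 * ‖x - z‖)))) ≤
      (3 * (5 * (4 * π)⁻¹ + 8 / π) * (3 * (volume : Measure (EuclideanSpace ℝ (Fin 3))).real (ball 0 1))) *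
        (M * ‖x - z‖ * (1 + Real.log (R / ‖x - z‖))) := by
    have h1 : 5 * (4 * π)⁻¹ + 8 / π * Real.log (R / (2 * ‖x - z‖)) ≤
        (5 * (4 * π)⁻¹ + 8 / π) * (1 + Real.log (R / ‖x - z‖)) := by nlinarith
    have h2 : 0 ≤ M * (3 * (volume : Measure (EuclideanSpace ℝ (Fin 3))).real (ball 0 1)) * ‖x - z‖ := by
      positivity
    nlinarith
  have T2 : Λ * (3 * (volume : Measure (EuclideanSpace ℝ (Fin 3))).real (ball 0 1)) * ‖x - z‖ *
        (8 * (4 * π)⁻¹ * ‖x - z‖ + 8 / π * R) ≤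
      ((2 * (4 * π)⁻¹ + 8 / π) * (3 * (volume : Measure (EuclideanSpace ℝ (Fin 3))).real (ball 0 1))) *
        (Λ * ‖x - z‖ * R) := by
    have h1 : 8 * (4 * π)⁻¹ * ‖x - z‖ + 8 / π * R ≤ (2 * (4 * π)⁻¹ + 8 / π) * R := by nlinarith
    have h2 : 0 ≤ Λ * (3 * (volume : Measure (EuclideanSpace ℝ (Fin 3))).real (ball 0 1)) * ‖x - z‖ := by
      positivity
    nlinarith
  have T3 : 3 * (8 * (8 / π) * ‖x - z‖ / R ^ 3 * I) + 8 * (8 / π) * ‖x - z‖ / R ^ 3 * I =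
      (32 * (8 / π)) * (I * ‖x - z‖ / R ^ 3) := by
    ring
  have f1 : 0 ≤ M * ‖x - z‖ * (1 + Real.log (R / ‖x - z‖)) := by positivity
  have f2 : 0 ≤ Λ * ‖x - z‖ * R := by positivity
  have f3 : 0 ≤ I * ‖x - z‖ / R ^ 3 := by positivity
  have k1 : 0 ≤ 3 * (5 * (4 * π)⁻¹ + 8 / π) * (3 * (volume : Measure (EuclideanSpace ℝ (Fin 3))).real (ball 0 1)) := by
    positivity
  have k2 : 0 ≤ (2 * (4 * π)⁻¹ + 8 / π) * (3 * (volume : Measure (EuclideanSpace ℝ (Fin 3))).real (ball 0 1)) := by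
    positivity
  have k3 : (0 : ℝ) ≤ 32 * (8 / π) := by positivity
  nlinarith [mul_nonneg k1 (add_nonneg f2 f3), mul_nonneg k2 (add_nonneg f1 f3),
    mul_nonneg k3 (add_nonneg f1 f2)]

include hw hwc hxz hR hBm hEm hFvi hFdi hΩ hD hM hΛ hI hB hBR hE hER hFvn hFvR hFvI hFdn hFdR hFdI in
/-- **The log-Lipschitz bound for a Lipschitz compactly supported field** (Yudovich's estimate
in decomposed form; Majda–Bertozzi Lemma 8.1): with the vorticity and divergence of `w`
decomposed a.e. as in `abs_integral_regDelta_sub_le` and `0 < 4|x − z| ≤ R`,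
`‖w(x) − w(z)‖ ≤ (3K₀/m₀) (M d (1 + log(R/d)) + Λ d R + I d R⁻³)`, `d = |x − z|`, with the
absolute constants `K₀` of `abs_integral_regDelta_sub_le` and `m₀ = ∫ regDelta 1 > 0`
(`integral_regDelta_one_pos`): the level-`ε` bound and `ε → 0` through the approximate
identity estimate `|∫ regDelta ε (p − y) wᵢ(y) dy − m₀ wᵢ(p)| ≤ C|ε| m₁`.
[cite: MajdaBertozziCUP2002, Lemma 8.1] -/
theorem norm_sub_le_of_lipschitz_decomposition :
    ‖w x - w z‖ ≤
      (3 * (3 * (5 * (4 * π)⁻¹ + 8 / π) * (3 * (volume : Measure (EuclideanSpace ℝ (Fin 3))).real (ball 0 1)) +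
          (2 * (4 * π)⁻¹ + 8 / π) * (3 * (volume : Measure (EuclideanSpace ℝ (Fin 3))).real (ball 0 1)) +
          32 * (8 / π)) / ∫ u, regDelta (1 : ℝ) u) *
      (M * ‖x - z‖ * (1 + Real.log (R / ‖x - z‖)) + Λ * ‖x - z‖ * R + I * ‖x - z‖ / R ^ 3) := by
  obtain ⟨K₀, hK₀⟩ : ∃ K₀ : ℝ, K₀ = 3 * (5 * (4 * π)⁻¹ + 8 / π) *
      (3 * (volume : Measure (EuclideanSpace ℝ (Fin 3))).real (ball 0 1)) +
      (2 * (4 * π)⁻¹ + 8 / π) * (3 * (volume : Measure (EuclideanSpace ℝ (Fin 3))).real (ball 0 1)) +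
      32 * (8 / π) := ⟨_, rfl⟩
  obtain ⟨S, hS⟩ : ∃ S : ℝ, S = M * ‖x - z‖ * (1 + Real.log (R / ‖x - z‖)) + Λ * ‖x - z‖ * R +
      I * ‖x - z‖ / R ^ 3 := ⟨_, rfl⟩
  obtain ⟨m₀, hm₀_def⟩ : ∃ m : ℝ, m = ∫ u, regDelta (1 : ℝ) u := ⟨_, rfl⟩
  obtain ⟨m₁, hm₁_def⟩ : ∃ m : ℝ, m = ∫ u, ‖u‖ * regDelta 1 u := ⟨_, rfl⟩
  rw [← hK₀, ← hS, ← hm₀_def]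
  have hm₀ : 0 < m₀ := by rw [hm₀_def]; exact integral_regDelta_one_pos
  have hm₁ : 0 ≤ m₁ := by
    rw [hm₁_def]
    exact integral_nonneg fun u => mul_nonneg (norm_nonneg _) (regDelta_nonneg 1 u)
  have hd : 0 < ‖x - z‖ := norm_pos_iff.2 (sub_ne_zero.2 hxz)
  have hR0 : 0 < R := by linarith
  have hlog0 : 0 ≤ Real.log (R / ‖x - z‖) := Real.log_nonneg ((one_le_div hd).2 (by linarith))
  have hS0 : 0 ≤ S := by rw [hS]; positivity
  have hK₀0 : 0 ≤ K₀ := by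
    rw [hK₀]
    have := three_mul_volume_real_ball_nonneg
    positivity
  -- per component
  have hcomp : ∀ i, m₀ * |w x i - w z i| ≤ K₀ * S := by
    intro i
    refine le_of_forall_pos_le_add fun η hη => ?_
    -- choose `ε` with `2 C ε m₁ ≤ η`
    have hden : 0 < 2 * (C : ℝ) * m₁ + 1 := by positivity
    obtain ⟨ε, hε_def⟩ : ∃ ε : ℝ, ε = η / (2 * C * m₁ + 1) := ⟨_, rfl⟩
    have hε : 0 < ε := by rw [hε_def]; exact div_pos hη hden
    have hεη : 2 * C * ε * m₁ ≤ η := by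
      have h1 : ε * (2 * C * m₁ + 1) = η := by
        rw [hε_def, div_mul_cancel₀ _ hden.ne']
      nlinarith [mul_nonneg hε.le (mul_nonneg (mul_nonneg zero_le_two C.coe_nonneg) hm₁)]
    have hlev := abs_integral_regDelta_sub_le hw hwc hxz hR hBm hEm hFvi hFdi hΩ hD hM hΛ hI hB hBR
      hE hER hFvn hFvR hFvI hFdn hFdR hFdI hε.ne' i
    rw [← hK₀, ← hS] at hlev
    have hax := abs_integral_regDelta_mul_sub_le hε.ne' (hw i) x
    have haz := abs_integral_regDelta_mul_sub_le hε.ne' (hw i) z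
    rw [abs_of_pos hε, ← hm₀_def, ← hm₁_def] at hax haz
    have key : |m₀ * w x i - m₀ * w z i| ≤ K₀ * S + 2 * C * ε * m₁ := by
      have e : m₀ * w x i - m₀ * w z i =
          -((∫ y, regDelta ε (x - y) * w y i) - m₀ * w x i) +
          ((∫ y, regDelta ε (x - y) * w y i) - ∫ y, regDelta ε (z - y) * w y i) +
          ((∫ y, regDelta ε (z - y) * w y i) - m₀ * w z i) := by ring
      rw [e]
      have h1 : |-((∫ y, regDelta ε (x - y) * w y i) - m₀ * w x i)| ≤ C * ε * m₁ := by
        rw [abs_neg]; exact hax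
      calc |-((∫ y, regDelta ε (x - y) * w y i) - m₀ * w x i) +
            ((∫ y, regDelta ε (x - y) * w y i) - ∫ y, regDelta ε (z - y) * w y i) +
            ((∫ y, regDelta ε (z - y) * w y i) - m₀ * w z i)|
          ≤ |-((∫ y, regDelta ε (x - y) * w y i) - m₀ * w x i) +
            ((∫ y, regDelta ε (x - y) * w y i) - ∫ y, regDelta ε (z - y) * w y i)| +
            |(∫ y, regDelta ε (z - y) * w y i) - m₀ * w z i| := abs_add_le _ _
        _ ≤ (|-((∫ y, regDelta ε (x - y) * w y i) - m₀ * w x i)| +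
            |(∫ y, regDelta ε (x - y) * w y i) - ∫ y, regDelta ε (z - y) * w y i|) +
            |(∫ y, regDelta ε (z - y) * w y i) - m₀ * w z i| := by
            gcongr; exact abs_add_le _ _
        _ ≤ (C * ε * m₁ + K₀ * S) + C * ε * m₁ := add_le_add (add_le_add h1 hlev) haz
        _ = K₀ * S + 2 * C * ε * m₁ := by ring
    rw [← mul_sub, abs_mul, abs_of_pos hm₀] at key
    linarith
  -- sum over components
  have hKS : 0 ≤ K₀ * S := by positivity
  calc ‖w x - w z‖ ≤ ∑ i, |(w x - w z) i| := norm_le_sum_abs _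
    _ = ∑ i, |w x i - w z i| := by simp
    _ ≤ ∑ _i : Fin 3, K₀ * S / m₀ := Finset.sum_le_sum fun i _ => by
        rw [le_div_iff₀ hm₀, mul_comm]
        exact hcomp i
    _ = 3 * K₀ / m₀ * S := by
        rw [Finset.sum_const, Finset.card_univ, Fintype.card_fin, nsmul_eq_mul, Nat.cast_ofNat]
        ring

end LogLipschitz

end NewtonPotentialHolder

end Literature.Analysis.FluidPDE
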